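import Summits.HodgeConjecture.CorCM.GaloisTwiceOddDegenerateTypes
import Literature.AlgebraicGeometry.Pohlmann1968.MumfordSimpleFourfoldOfPrimitive
import HarnessLib

/-!
# Exceptional Hodge classes ON the simple CM abelian variety itself, in codimension `|V|`; the even-degree companion

COR-CM (cell `pub-hodgecm2`), binder seat b04 (gen 19), count-neutral claim GALOIS-TWICE-ODD, part V (sequel of
`GaloisBalancedWeightDegenerate`, `GaloisTwiceOddDegenerateTypes`).  KERNEL ONLY: theorems; no definition, no named
fact, no `sorry`.  `HC_CM` is neither used nor claimed.

Parts III–IV produce, for a Galois CM field `K` of twice-odd composite degree `2m`, a simple degenerate CM abelian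
variety of dimension `m` with an exceptional Hodge class on SOME POWER (Hazama's criterion).  The balanced set
`D = V ∪ c·V·y₀` of part II is a set of `2|V|` embeddings meeting EVERY Galois translate of the type in exactly `|V|`
elements and containing no conjugate of `σ_1` among … — precisely a Pohlmann set which is not conjugation-stable, so
White's form of Pohlmann's theorem (Gordon 9.2.2; tree `exists_exceptional_iff_of_primitive`) puts an exceptional
Hodge class in `H^{2|V|}` of the abelian variety ITSELF:

* §1 **`exists_exceptional_of_galois_balanced`** — `Φ` primitive read on `Gal(K/ℚ)` as `S`, `D` balanced
  (`2·#{x ∈ D : x g ∈ S} = #D`), `1 ∈ D`, `c ∉ D`, `#D = 2q` ⟹ every realisation `A` of `(K; Φ)` carries a rational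
  `(q,q)`-class outside `D^q(A) ⊗ ℂ`.
* §2 **`exists_simple_exceptional_of_subgroup`**, **`exists_simple_exceptional_of_twice_odd`** — for `[K:ℚ] = 2m`,
  `m` odd, and ANY prime `p ∣ m`, `p ≠ m`: a SIMPLE abelian variety of dimension `m` with CM by `K` and an
  exceptional Hodge class in codimension `p` on itself (e.g. codimension `3` in dimension `9, 15, 21, 27, …`).
* §3 the EVEN-degree companion over an imaginary quadratic subfield `k ⊆ K`:
  **`exists_isPrimitive_not_isNondegenerate_of_quadratic_of_lt`** — `p` an odd prime with `p ∣ [K : k]` and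
  `2p < [K : k]` ⟹ a primitive degenerate CM type (and a simple CM abelian variety of dimension `[K:k]` with an
  exceptional class in codimension `p`); the group lemma `card_le_two_mul_of_forall_mul_self_eq_one` supplies the
  non-involution outside `V` (if every element of `H ∖ V` were an involution, `|H| ≤ 2|V|`).  The bound `2p < [K:k]`
  cannot be dropped from THIS criterion: for `Gal(K/k) = D_p` (`[K:k] = 2p`) every element outside `C_p` is an
  involution — `ℤ/2 × S₃` (`p = 3`) is good (gen 14), while `D_p` for `p ≥ 5` is bad by the Weil-type mechanism of
  parts VI–VII.

## References

* [Gordon1999HodgeAVSurvey] B. B. Gordon, *A survey of the Hodge conjecture for abelian varieties*, 9.2.2, §9.3, §9.4.3.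
* [Pohlmann1968] H. Pohlmann, *Algebraic cycles on abelian varieties of complex multiplication type*, Ann. of Math.
  88 (1968), Thm. 1.
* [Dodson1984] B. Dodson, *The structure of Galois groups of CM-fields*, Trans. AMS 283 (1984), §3.1.1.
* [Shimura1998] G. Shimura, *Abelian Varieties with Complex Multiplication and Modular Functions*, §6.2 Thm. 3, §8.2 Prop. 26.
-/

noncomputable section

open CategoryTheory CategoryTheory.Limits NumberField
open scoped BigOperators

namespace Summit.HodgeConjecture.CorCM.TwiceOdd

open Literature.NumberTheory.ComplexMultiplication
open Literature.AlgebraicGeometry.Motives (AbelianVariety CMType)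
open Literature.AlgebraicGeometry.HodgeTheory
open Literature.AlgebraicGeometry.ComplexMultiplication (IsCMTypeRealisation isSimple_iff_isPrimitive)
open Literature.AlgebraicGeometry.Pohlmann1968
open Literature.Barriers.HodgeConjecture (divisorClassesSpan)
open Summit.HodgeConjecture.CorCM.GaloisOctic (embOf_complexConj_mul complexConj_mul_comm complexConj_mul_self
  complexConj_not_mem_fixingSubgroup)
open Summit.HodgeConjecture.CorCM.AbelianSixteen (exists_simple_realisation_of_isPrimitive)

open scoped Classical

variable {K : Type} [Field K] [NumberField K] [IsCMField K]

/-! ## §1 A balanced set on the Galois group is a Pohlmann set: an exceptional class on `A` itself -/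

section OnA

variable {Φ : CMType K} {A : AbelianVariety ℂ} {ι : 𝓞 K →+* End A} {θ : K →+* Module.End ℂ (complexBetti A.X 1)}

/-- **A balanced finset `D ⊆ Gal(K/ℚ)` moved by `c` indexes an exceptional Hodge class on `A` itself.**  `K/ℚ`
Galois CM, `Φ` PRIMITIVE read on `Gal(K/ℚ)` as `S`, `D` with `2·#{x ∈ D : x g ∈ S} = #D` for all `g`, `1 ∈ D`,
`c ∉ D`, `#D = 2q`: then `σ(D) = {σ_x : x ∈ D}` is a Pohlmann set of `Φ` (`|σ(D) ∩ τΦ| = q` for every `τ`) which is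
not conjugation-stable, so every realisation `(A, ι, θ)` of `(K; Φ)` carries a rational `(q,q)`-class outside
`D^q(A) ⊗ ℂ` (White's form of Pohlmann's theorem for simple `A`). [cite: Gordon1999HodgeAVSurvey, 9.2.2]
[cite: Pohlmann1968, Thm. 1] -/
theorem exists_exceptional_of_galois_balanced [IsGalois ℚ K] (φ₀ : K →+* ℂ) (hprim : IsPrimitive (ℂ ≃+* ℂ) Φ.1 φ₀)
    (S : Finset (K ≃ₐ[ℚ] K)) (hS : ∀ g, g ∈ S ↔ embOf φ₀ g ∈ Φ.1) (D : Finset (K ≃ₐ[ℚ] K))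
    (hbal : ∀ g : K ≃ₐ[ℚ] K, 2 * (D.filter fun x => x * g ∈ S).card = D.card) (h1D : (1 : K ≃ₐ[ℚ] K) ∈ D)
    (hcD : (IsCMField.complexConj K).restrictScalars ℚ ∉ D) {q : ℕ} (hq : D.card = 2 * q)
    (hA : IsCMTypeRealisation Φ A ι θ) :
    ∃ x : complexBetti A.X (2 * q), IsRationalClass x ∧
      IsOfHodgeType (Module.finrank ℚ K / 2) A.X (2 * q) q q x ∧
      x ∉ divisorClassesSpan A.X (Module.finrank ℚ K / 2) q := by
  haveI := isPretransitive_ringEquiv_complex (K := K)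
  have hinj : Function.Injective (embOf φ₀) := (embOf_bijective φ₀).1
  rw [exists_exceptional_iff_of_primitive hA ((isPrimitive_iff_forall_eq Φ.1 φ₀).1 hprim) q]
  refine ⟨D.image (embOf φ₀), ?_, embOf φ₀ 1, Finset.mem_image_of_mem _ h1D, ?_⟩
  · rw [mem_pohlmannSets_iff, Finset.card_image_of_injective _ hinj, hq]
    refine ⟨rfl, fun τ => ?_⟩
    obtain ⟨γ, hγ⟩ := exists_algEquiv_comp_eq_smul φ₀ τ
    -- both sides are images of the two halves of `D` under `x ↦ σ_x`
    have hset : ∀ P : (K →+* ℂ) → Prop, {s | s ∈ D.image (embOf φ₀) ∧ P s} =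
        ↑((D.filter fun x => P (embOf φ₀ x)).image (embOf φ₀)) := by
      intro P
      ext s
      simp only [Set.mem_setOf_eq, Finset.coe_image, Finset.coe_filter, Set.mem_image, Finset.mem_image]
      constructor
      · rintro ⟨⟨x, hx, rfl⟩, hP⟩
        exact ⟨x, ⟨hx, hP⟩, rfl⟩
      · rintro ⟨x, ⟨hx, hP⟩, rfl⟩
        exact ⟨⟨x, hx, rfl⟩, hP⟩
    have hcomp : ∀ x, (τ : ℂ →+* ℂ).comp (embOf φ₀ x) ∈ Φ.1 ↔ x * γ⁻¹ ∈ S := by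
      intro x
      rw [hS, ← smul_embOf_of_comp φ₀ hγ]
      rfl
    rw [hset, hset, Set.ncard_coe_finset, Set.ncard_coe_finset, Finset.card_image_of_injective _ hinj,
      Finset.card_image_of_injective _ hinj]
    simp_rw [hcomp]
    have h1 := hbal γ⁻¹
    have h2 := Finset.card_filter_add_card_filter_not (s := D) (fun x => x * γ⁻¹ ∈ S)
    omega
  · rw [← embOf_complexConj_mul, mul_one, Finset.mem_image]
    rintro ⟨x, hx, h⟩
    exact hcD (hinj h ▸ hx)

end OnA

/-! ## §2 Simple CM abelian varieties with an exceptional class in codimension `|V|` -/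

/-- **Subgroup data ⟹ a SIMPLE CM abelian variety with an exceptional Hodge class in codimension `|V|` on itself.**
`K/ℚ` Galois CM; `H ≤ Gal(K/ℚ)` with `c ∉ H`, `G = H ∪ cH`; `V ≤ H`, `3 ≤ |V|`; `y₀ ∈ H ∖ V` a non-involution.  Then
there are a primitive degenerate CM type `Φ` and a SIMPLE realisation `A` of dimension `[K:ℚ]/2` with a rational
`(|V|,|V|)`-class outside `D^{|V|}(A) ⊗ ℂ`. [cite: Gordon1999HodgeAVSurvey, 9.2.2]
[cite: Shimura1998, §6.2 Thm. 3 and §8.2 Prop. 26] [cite: Dodson1984, §3.1.1] -/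
theorem exists_simple_exceptional_of_subgroup [IsGalois ℚ K] (H V : Subgroup (K ≃ₐ[ℚ] K))
    (hcH : (IsCMField.complexConj K).restrictScalars ℚ ∉ H)
    (hH : ∀ g : K ≃ₐ[ℚ] K, g ∈ H ∨ (IsCMField.complexConj K).restrictScalars ℚ * g ∈ H) (hVH : V ≤ H)
    (h3 : 3 ≤ Nat.card V) {y₀ : K ≃ₐ[ℚ] K} (hy₀H : y₀ ∈ H) (hy₀V : y₀ ∉ V) (hy₀2 : y₀ * y₀ ≠ 1) :
    ∃ (Φ : CMType K) (φ₀ : K →+* ℂ) (A : AbelianVariety ℂ) (ι : 𝓞 K →+* End A)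
      (θ : K →+* Module.End ℂ (complexBetti A.X 1)),
      IsPrimitive (ℂ ≃+* ℂ) Φ.1 φ₀ ∧ ¬ IsNondegenerate Φ ∧ IsCMTypeRealisation Φ A ι θ ∧ A.IsSimple ∧
      A.dim = Module.finrank ℚ K / 2 ∧
      ∃ x : complexBetti A.X (2 * Nat.card V), IsRationalClass x ∧
        IsOfHodgeType (Module.finrank ℚ K / 2) A.X (2 * Nat.card V) (Nat.card V) (Nat.card V) x ∧
        x ∉ divisorClassesSpan A.X (Module.finrank ℚ K / 2) (Nat.card V) := by
  obtain ⟨φ₀⟩ := (inferInstance : Nonempty (K →+* ℂ))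
  set c : K ≃ₐ[ℚ] K := (IsCMField.complexConj K).restrictScalars ℚ with hc_def
  obtain ⟨S, D, hcm, hstab, hbal, h1D, hcD, hcard⟩ := exists_halfSystem_of_subgroup (c := c) complexConj_mul_self
    (fun g => complexConj_mul_comm g) hcH hH hVH h3 hy₀H hy₀V hy₀2
  obtain ⟨Φ, hprim, hread⟩ := GaloisTable.exists_isPrimitive_of_tableModel (K := K) (X := K ≃ₐ[ℚ] K)
    (fun a b => a * b) (Equiv.refl _) (fun _ _ => rfl) c rfl 1 rfl S hcm hstab φ₀
  have hS : ∀ g, g ∈ S ↔ embOf φ₀ g ∈ Φ.1 := fun g => by simpa using hread g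
  have hdeg : ¬ IsNondegenerate Φ :=
    not_isNondegenerate_of_galois_balanced Φ φ₀ S hS D hbal ⟨1, h1D, by rw [mul_one]; exact hcD⟩
  obtain ⟨A, ι, θ, hA, hs, hdim⟩ := exists_simple_realisation_of_isPrimitive Φ φ₀ hprim
  exact ⟨Φ, φ₀, A, ι, θ, hprim, hdeg, hA, hs, hdim,
    exists_exceptional_of_galois_balanced φ₀ hprim S hS D hbal h1D hcD hcard hA⟩

/-- **Twice-odd degree, on `A` itself.**  `K/ℚ` Galois CM of degree `2m`, `m` odd; `p` a prime with `p ∣ m`,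
`p ≠ m`.  Then some SIMPLE abelian variety `A` of dimension `m` with CM by `K` carries a rational `(p,p)`-class
outside `Dᵖ(A) ⊗ ℂ` — an exceptional Hodge class in codimension `p` (e.g. codimension `3` on simple CM abelian
varieties of dimension `9, 15, 21, 27, 33, …`; codimension `5` in dimension `25, 35, …`).
[cite: Gordon1999HodgeAVSurvey, 9.2.2 and §9.4.3] [cite: Dodson1984, §3.2.1] [cite: Shimura1998, §6.2 Thm. 3 and §8.2 Prop. 26] -/
theorem exists_simple_exceptional_of_twice_odd [IsGalois ℚ K] {m : ℕ} (hm : Odd m)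
    (hK : Module.finrank ℚ K = 2 * m) {p : ℕ} (hp : p.Prime) (hpm : p ∣ m) (hpm' : p ≠ m) :
    ∃ (Φ : CMType K) (φ₀ : K →+* ℂ) (A : AbelianVariety ℂ) (ι : 𝓞 K →+* End A)
      (θ : K →+* Module.End ℂ (complexBetti A.X 1)),
      IsPrimitive (ℂ ≃+* ℂ) Φ.1 φ₀ ∧ ¬ IsNondegenerate Φ ∧ IsCMTypeRealisation Φ A ι θ ∧ A.IsSimple ∧ A.dim = m ∧
      ∃ x : complexBetti A.X (2 * p), IsRationalClass x ∧ IsOfHodgeType m A.X (2 * p) p p x ∧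
        x ∉ divisorClassesSpan A.X m p := by
  obtain ⟨H, V, y₀, hcH, hH, -, hVH, hVp, h3, hy₀H, hy₀V, hy₀2⟩ := exists_subgroups_of_twice_odd hm hK hp hpm hpm'
  have hKm : Module.finrank ℚ K / 2 = m := by rw [hK, Nat.mul_div_cancel_left _ (by norm_num : 0 < 2)]
  obtain ⟨Φ, φ₀, A, ι, θ, hprim, hdeg, hA, hs, hdim, hx⟩ :=
    exists_simple_exceptional_of_subgroup H V hcH hH hVH h3 hy₀H hy₀V hy₀2
  rw [hVp, hKm] at hx
  rw [hKm] at hdim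
  exact ⟨Φ, φ₀, A, ι, θ, hprim, hdeg, hA, hs, hdim, hx⟩

/-! ## §3 The even-degree companion over an imaginary quadratic subfield -/

section Group

variable {G : Type*} [Group G] [Fintype G] {V H : Subgroup G}

/-- **If every element of `H ∖ V` is an involution then `|H| ≤ 2|V|`** (`V ≤ H` containing a non-involution `v`):
for `y₁, y ∈ H ∖ V` with `y₁ y ∉ V` the involutions `y₁, y, y₁y` (so `y₁, y` commute), `y₁v`, `yv`, `y₁yv` give
`y₁ v y₁ = v⁻¹ = y v y` and `v⁻¹ = (y₁y) v (y₁y) = y₁ (y v y) y₁ = v`, i.e. `v² = 1`; hence `H ∖ V ⊆ y₁⁻¹ V`. [folklore] -/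
theorem card_le_two_mul_of_forall_mul_self_eq_one (hVH : V ≤ H) {v : G} (hv : v ∈ V) (hvv : v * v ≠ 1)
    (hinv : ∀ y ∈ H, y ∉ V → y * y = 1) : Nat.card H ≤ 2 * Nat.card V := by
  set HF : Finset G := Finset.univ.filter fun g => g ∈ H with hHF
  set VF : Finset G := Finset.univ.filter fun g => g ∈ V with hVF
  have hHFc : HF.card = Nat.card H := by rw [hHF, Nat.card_eq_fintype_card, ← Fintype.card_subtype]
  have hVFc : VF.card = Nat.card V := by rw [hVF, Nat.card_eq_fintype_card, ← Fintype.card_subtype]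
  have hmemH : ∀ g, g ∈ HF ↔ g ∈ H := fun g => by rw [hHF, Finset.mem_filter]; simp
  have hmemV : ∀ g, g ∈ VF ↔ g ∈ V := fun g => by rw [hVF, Finset.mem_filter]; simp
  rw [← hHFc, ← hVFc]
  by_cases hall : ∀ y ∈ H, y ∈ V
  · have : HF ⊆ VF := fun y hy => (hmemV y).2 (hall y ((hmemH y).1 hy))
    have := Finset.card_le_card this
    omega
  push Not at hall
  obtain ⟨y₁, hy₁H, hy₁V⟩ := hall
  -- conjugation of `v` by an involution of `H ∖ V` inverts `v`
  have hconj : ∀ y ∈ H, y ∉ V → y * v * y = v⁻¹ := by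
    intro y hyH hyV
    have hyv : y * v ∉ V := fun h => hyV (by simpa using V.mul_mem h (V.inv_mem hv))
    have h1 := hinv (y * v) (H.mul_mem hyH (hVH hv)) hyv
    -- `y v y v = 1` ⟹ `y v y = v⁻¹`
    rw [← mul_assoc] at h1
    exact mul_eq_one_iff_eq_inv.1 h1
  -- the key inclusion `H ∖ V ⊆ y₁⁻¹ V`
  have hkey : ∀ y ∈ H, y ∉ V → y₁ * y ∈ V := by
    intro y hyH hyV
    by_contra hy₁y
    have hy₁₁ := hinv y₁ hy₁H hy₁V
    have hyy := hinv y hyH hyV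
    have hpp := hinv (y₁ * y) (H.mul_mem hy₁H hyH) hy₁y
    -- `y₁` and `y` commute
    have hcomm : y₁ * y = y * y₁ := by
      have h : y₁ * y = (y₁ * y)⁻¹ := (mul_eq_one_iff_eq_inv.1 hpp)
      rw [h, mul_inv_rev, (mul_eq_one_iff_eq_inv.1 hy₁₁).symm, (mul_eq_one_iff_eq_inv.1 hyy).symm]
    have h1 := hconj y₁ hy₁H hy₁V
    have h2 := hconj y hyH hyV
    have h3 := hconj (y₁ * y) (H.mul_mem hy₁H hyH) hy₁y
    -- `(y₁ y) v (y₁ y) = y₁ (y v y) y₁ = y₁ v⁻¹ y₁ = (y₁ v y₁)⁻¹ = v`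
    have h4 : y₁ * y * v * (y₁ * y) = v := by
      calc y₁ * y * v * (y₁ * y) = y₁ * y * v * (y * y₁) := by rw [hcomm]
        _ = y₁ * (y * v * y) * y₁ := by simp only [mul_assoc]
        _ = y₁ * v⁻¹ * y₁ := by rw [h2]
        _ = (y₁⁻¹ * v * y₁⁻¹)⁻¹ := by simp only [mul_inv_rev, inv_inv, mul_assoc]
        _ = (y₁ * v * y₁)⁻¹ := by rw [(mul_eq_one_iff_eq_inv.1 hy₁₁).symm]
        _ = v := by rw [h1, inv_inv]
    rw [h4] at h3
    exact hvv (mul_eq_one_iff_eq_inv.2 h3)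
  -- count: `HF ⊆ VF ∪ {y : y₁ y ∈ V}` and the latter injects into `VF`
  have hsub : HF ⊆ VF ∪ HF.filter fun y => y₁ * y ∈ V := by
    intro y hy
    by_cases hyV : y ∈ V
    · exact Finset.mem_union_left _ ((hmemV y).2 hyV)
    · exact Finset.mem_union_right _ (Finset.mem_filter.2 ⟨hy, hkey y ((hmemH y).1 hy) hyV⟩)
  have hle1 := Finset.card_le_card hsub
  have hle2 := Finset.card_union_le VF (HF.filter fun y => y₁ * y ∈ V)
  have hle3 : (HF.filter fun y => y₁ * y ∈ V).card ≤ VF.card := by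
    refine Finset.card_le_card_of_injOn (fun y => y₁ * y) (fun y hy => ?_) fun a _ b _ hab => mul_left_cancel hab
    rw [Finset.mem_coe, Finset.mem_filter] at hy
    rw [Finset.mem_coe, hmemV]
    exact hy.2
  omega

end Group

/-- **Even-degree companion.**  `K/ℚ` Galois CM, `k ⊆ K` of degree `2` with a complex place (an imaginary quadratic
subfield), `p` an ODD prime with `p ∣ [K : k]` and `2p < [K : k]`.  Then `K` has a PRIMITIVE DEGENERATE CM type: an
element of order `p` of `Gal(K/k)` (Cauchy) generates `V` with `|V| = p ≥ 3`, and since `|Gal(K/k)| > 2|V|` some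
element of `Gal(K/k) ∖ V` is not an involution (`card_le_two_mul_of_forall_mul_self_eq_one`); part III.  (For
`[K:k] = 2p` with `Gal(K/k)` dihedral the criterion is silent: `p = 3` is good, gen 14; `p ≥ 5` is bad, part VII.)
[cite: Dodson1984, §3.1.1 and §3.3.1] [cite: Shimura1998, §8.2 Prop. 26] [cite: Gordon1999HodgeAVSurvey, §9.4.3] -/
theorem exists_isPrimitive_not_isNondegenerate_of_quadratic_of_lt [IsGalois ℚ K] (k : IntermediateField ℚ K)
    (hk : Module.finrank ℚ k = 2) (τ₀ : k →+* ℂ) (hτ₀ : ComplexEmbedding.conjugate τ₀ ≠ τ₀) {p : ℕ}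
    (hp : p.Prime) (hp2 : p ≠ 2) (hpd : p ∣ Module.finrank k K) (hlt : 2 * p < Module.finrank k K)
    (φ₀ : K →+* ℂ) : ∃ Φ : CMType K, IsPrimitive (ℂ ≃+* ℂ) Φ.1 φ₀ ∧ ¬ IsNondegenerate Φ := by
  set H : Subgroup (K ≃ₐ[ℚ] K) := k.fixingSubgroup with hH_def
  have hHcard : Nat.card H = Module.finrank k K := IsGalois.card_fixingSubgroup_eq_finrank k
  -- `V` of order `p`
  haveI : Fact p.Prime := ⟨hp⟩
  obtain ⟨x, hx⟩ := exists_prime_orderOf_dvd_card' (G := H) p (by rw [hHcard]; exact hpd)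
  set V : Subgroup (K ≃ₐ[ℚ] K) := Subgroup.zpowers (x : K ≃ₐ[ℚ] K) with hV
  have hVH : V ≤ H := by rw [hV, Subgroup.zpowers_le]; exact x.2
  have hxord : orderOf (x : K ≃ₐ[ℚ] K) = p := by rw [Subgroup.orderOf_coe, hx]
  have hVcard : Nat.card V = p := by rw [hV, Nat.card_zpowers, hxord]
  have hp3 : 3 ≤ p := by have := hp.two_le; omega
  -- `x` is not an involution
  have hxx : (x : K ≃ₐ[ℚ] K) * x ≠ 1 := by
    intro h
    have hdvd : orderOf (x : K ≃ₐ[ℚ] K) ∣ 2 := orderOf_dvd_of_pow_eq_one (by rw [pow_two, h])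
    rw [hxord] at hdvd
    have := Nat.le_of_dvd (by norm_num) hdvd
    omega
  -- a non-involution outside `V`
  have hy : ∃ y₀ ∈ H, y₀ ∉ V ∧ y₀ * y₀ ≠ 1 := by
    by_contra hno
    push Not at hno
    have hle := card_le_two_mul_of_forall_mul_self_eq_one hVH (Subgroup.mem_zpowers (x : K ≃ₐ[ℚ] K)) hxx hno
    rw [hHcard, hVcard] at hle
    omega
  obtain ⟨y₀, hy₀H, hy₀V, hy₀2⟩ := hy
  exact exists_isPrimitive_not_isNondegenerate_of_quadratic k hk τ₀ hτ₀ V hVH (hVcard ▸ hp3) hy₀H hy₀V hy₀2 φ₀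

/-- **Even-degree companion, realised on `A` itself**: under the same hypotheses a SIMPLE abelian variety of
dimension `[K : k]` with CM by `K` carrying a rational `(p,p)`-class outside `Dᵖ ⊗ ℂ` (an exceptional Hodge class in
codimension `p`). [cite: Gordon1999HodgeAVSurvey, 9.2.2] [cite: Shimura1998, §6.2 Thm. 3 and §8.2 Prop. 26] -/
theorem exists_simple_exceptional_of_quadratic_of_lt [IsGalois ℚ K] (k : IntermediateField ℚ K)
    (hk : Module.finrank ℚ k = 2) (τ₀ : k →+* ℂ) (hτ₀ : ComplexEmbedding.conjugate τ₀ ≠ τ₀) {p : ℕ}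
    (hp : p.Prime) (hp2 : p ≠ 2) (hpd : p ∣ Module.finrank k K) (hlt : 2 * p < Module.finrank k K) :
    ∃ (Φ : CMType K) (φ₀ : K →+* ℂ) (A : AbelianVariety ℂ) (ι : 𝓞 K →+* End A)
      (θ : K →+* Module.End ℂ (complexBetti A.X 1)),
      IsPrimitive (ℂ ≃+* ℂ) Φ.1 φ₀ ∧ ¬ IsNondegenerate Φ ∧ IsCMTypeRealisation Φ A ι θ ∧ A.IsSimple ∧
      A.dim = Module.finrank k K ∧
      ∃ x : complexBetti A.X (2 * p), IsRationalClass x ∧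
        IsOfHodgeType (Module.finrank k K) A.X (2 * p) p p x ∧
        x ∉ divisorClassesSpan A.X (Module.finrank k K) p := by
  obtain ⟨hcH, hH⟩ := mem_or_complexConj_mul_mem_of_quadratic k hk τ₀ hτ₀
  set H : Subgroup (K ≃ₐ[ℚ] K) := k.fixingSubgroup with hH_def
  have hHcard : Nat.card H = Module.finrank k K := IsGalois.card_fixingSubgroup_eq_finrank k
  have hKk : Module.finrank ℚ K / 2 = Module.finrank k K := by
    have h := Module.finrank_mul_finrank ℚ k K
    rw [hk] at h
    omega
  haveI : Fact p.Prime := ⟨hp⟩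
  obtain ⟨x, hx⟩ := exists_prime_orderOf_dvd_card' (G := H) p (by rw [hHcard]; exact hpd)
  set V : Subgroup (K ≃ₐ[ℚ] K) := Subgroup.zpowers (x : K ≃ₐ[ℚ] K) with hV
  have hVH : V ≤ H := by rw [hV, Subgroup.zpowers_le]; exact x.2
  have hxord : orderOf (x : K ≃ₐ[ℚ] K) = p := by rw [Subgroup.orderOf_coe, hx]
  have hVcard : Nat.card V = p := by rw [hV, Nat.card_zpowers, hxord]
  have hp3 : 3 ≤ p := by have := hp.two_le; omega
  have hxx : (x : K ≃ₐ[ℚ] K) * x ≠ 1 := by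
    intro h
    have hdvd : orderOf (x : K ≃ₐ[ℚ] K) ∣ 2 := orderOf_dvd_of_pow_eq_one (by rw [pow_two, h])
    rw [hxord] at hdvd
    have := Nat.le_of_dvd (by norm_num) hdvd
    omega
  have hy : ∃ y₀ ∈ H, y₀ ∉ V ∧ y₀ * y₀ ≠ 1 := by
    by_contra hno
    push Not at hno
    have hle := card_le_two_mul_of_forall_mul_self_eq_one hVH (Subgroup.mem_zpowers (x : K ≃ₐ[ℚ] K)) hxx hno
    rw [hHcard, hVcard] at hle
    omega
  obtain ⟨y₀, hy₀H, hy₀V, hy₀2⟩ := hy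
  obtain ⟨Φ, φ₀, A, ι, θ, hprim, hdeg, hA, hs, hdim, hz⟩ :=
    exists_simple_exceptional_of_subgroup H V hcH hH hVH (hVcard ▸ hp3) hy₀H hy₀V hy₀2
  rw [hVcard, hKk] at hz
  rw [hKk] at hdim
  exact ⟨Φ, φ₀, A, ι, θ, hprim, hdeg, hA, hs, hdim, hz⟩

end Summit.HodgeConjecture.CorCM.TwiceOdd

end
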